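import Summits.ABC.IUTFork.Thm311Pilot
import Literature.IUT.LogThetaLattice.TensorPackets
import Literature.IUT.LogThetaLattice.VerticallyCoricLGP
import Literature.IUT.LogThetaLattice.PacketLogVolumes
import HarnessLib

/-!
# [IUTchIII] Theorem 3.11 in the author's terms, I: dictionary to the landed Literature typings of [IUTchIII] §3

Record-only file (D-0012) of the abc-iut cell (seat abc-iut-c312-1); TAKES NO SIDE. The cell's layer
L6 (seat abc-iut-L6-t4) has landed statements-first typings of [IUTchIII] §3 up to (not including)
Theorem 3.11 under `Literature/IUT/LogThetaLattice/` (TensorPackets = Prop. 3.1/3.2, VerticallyCoricLGP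
= Prop. 3.5, PacketLogVolumes = Prop. 3.9, HolomorphicHull = Rmk. 3.9.5, ThetaPilotObjects = Prop. 3.7
/ Def. 3.8, GlobalKummerNonInterference = Prop. 3.10). The Theorem 3.11 files A–H
(`Thm311Sig` … `Thm311Regions`) were written top-down over their own SIGNATURES. This file is the
kernel-checked part of the TODO-merge table: it records, as definitional equalities or one-line
bridges, how the signatures of A–C, G are instances/special cases of the landed Literature
vocabulary, so that a future merge replaces fields by the names below.

| signature (file) | Literature decl (landed) | relation (this file) |
|---|---|---|
| `LogShells.Packet1 v_ℚ` (A) | `MPacket1 D α` (TensorPackets, Prop. 3.2) | `packet1_eq` (rfl), `D := fun _ v ↦ L.carrier v` |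
| `LogShells.Packet j v_ℚ` (A) | `MPacketN ℚ D` (TensorPackets, Prop. 3.2) | `packet_eq` (rfl): the strictified packet IS the mono-analytic `n`-tensor packet over `𝕜 = ℚ` |
| `MRData.shellPk` (B) | `shellPacketN ℚ D I` (Prop. 3.2 (ii)) | intended value at non-archimedean `v_ℚ` (prose; `shell` as `AddSubgroup`) |
| `Column.Ind3`, non-archimedean clause (C) | `Prop35ii_a` (VerticallyCoricLGP, Prop. 3.5 (ii)(a)) | `Column.ind3_non_of_prop35ii_a` |
| `Column.MutualCompat` (C) | `Prop35ii_c`, `logKummerCorrespondence` (Prop. 3.5 (ii)(c), end) | readings differ: C = set-level translation invariance (cf. `iUnion_range_shift` there); theirs = roots-of-unity relation (prose) |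
| `PilotNouns.negLogTheta` (G) | `processionNormalized` (PacketLogVolumes, Prop. 3.9 (i)/Cor. 3.12 "average over `j ∈ F_l^⋇`") | `negLogTheta_eq_processionNormalized` |
| `PilotNouns.hull` (G) | `holomorphicHull O U` (HolomorphicHull, Rmk. 3.9.5 (i)) | level mismatch recorded: theirs on `Π_i k_i` (fields + topology), ours a `ClosureOperator` on regions of a `ℚ`-module (prose) |
| `Column.thetaPilot` (C) | `thetaPilotObject S Sp : Ob S.Clgp` (ThetaPilotObjects, Def. 3.8 (i)) | intended value: `frobObjLGP m := Ob S.Clgp` (prose) |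
| `Column.unitImage (m − m') m'` at `v_ℚ ∈ V^arc_ℚ` (C, archimedean clause of `Column.Ind3`) | `Prop35ii_b` (Prop. 3.5 (ii)(b)(2)) | INSTANTIATION NOTE (referee R7-C1-N1): must be the CHOSEN subset of the radius-`π` ball that "surjects, via the `m'`-th iterate of the log-link …, onto the subset of the group of units … on which this iterate is defined" (p. 105), NOT the full preimage under the exponential (unbounded) |
| `ThetaIndex` (A) | [IUTchI] Def. 3.1 (b)(c) (abc-iut-L5-t2; c312-5 `Real.thetaIndex`, c312-3 `PilotData`) | ELISION NOTE (referee B1-1): A keeps only `l⋇ ≥ 2`; "`l` prime" (Def. 3.1 (c)) and "odd residue characteristic" of `V^bad_mod` (Def. 3.1 (b)) are carried by the instances (`PilotData.l_prime`), to be re-checked where `l`-primality is load-bearing ([IUTchIV] constants) |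

[claim: Mochizuki2012, status: disputed]
Deliberately NOT here: any change to A–H; any judgement.
-/

noncomputable section

namespace Summit.ABC

namespace IUTFork

namespace Thm311

open Literature.IUT.LogThetaLattice

variable {T : ThetaIndex}

/-- The fibre `{v | v_ℚ}` as a `Fintype` (it is `Finite` by `ThetaIndex.fibre_finite`). [folklore] -/
instance ThetaIndex.fintypeFibre (T : ThetaIndex) (vQ : T.VQ) : Fintype (T.Fibre vQ) := Fintype.ofFinite _

/-- Classical decidable equality on the fibre (the Literature packets ask for it). [folklore] -/
instance ThetaIndex.decEqFibre (T : ThetaIndex) (vQ : T.VQ) : DecidableEq (T.Fibre vQ) :=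
  Classical.decEq _

/-- `F_l^⋇` as a `Fintype`. [folklore] -/
instance ThetaIndex.fintypeLabelStar (T : ThetaIndex) : Fintype T.LabelStar := Fintype.ofFinite _

/-! ## Tensor packets: A's packets are the Literature's mono-analytic packets over `ℚ` -/

namespace LogShells

variable (L : LogShells T)

/-- The strictified family of carriers indexed by the capsule: every factor `α ∈ S^±_{j+1}` carries the
same module `log(D⊢_v)`. [folklore] -/
abbrev capsuleCarriers (j : T.Label) (vQ : T.VQ) : T.Caps j → T.Fibre vQ → Type :=
  fun _ v => L.carrier v.1

/-- DICTIONARY: `Packet1` (A) is `Literature.IUT.LogThetaLattice.MPacket1` of the strictified family —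
definitionally. [folklore] -/
theorem packet1_eq (j : T.Label) (vQ : T.VQ) (i : T.Caps j) :
    L.Packet1 vQ = MPacket1 (L.capsuleCarriers j vQ) i := rfl

/-- DICTIONARY: `Packet j v_ℚ` (A) is `Literature.IUT.LogThetaLattice.MPacketN ℚ` of the strictified
family ([IUTchIII] Prop. 3.2 "`log(^A D⊢_{v_ℚ}) := ⊗_{α ∈ A} log(^α D⊢_{v_ℚ})`" with `A = S^±_{j+1}`) —
definitionally. [claim: Mochizuki2012, status: disputed] -/
theorem packet_eq (j : T.Label) (vQ : T.VQ) :
    L.Packet j vQ = MPacketN ℚ (L.capsuleCarriers j vQ) := rfl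

end LogShells

/-! ## (Ind3): the non-archimedean clause of C from the Literature's Prop. 3.5 (ii) (a) -/

namespace Column

variable {L : LogShells T} (C : Column L) (D : MRData L)

/-- DICTIONARY/BRIDGE: if the column's transported unit images at `(j, v_ℚ)` ARE the images of the
data of `Literature.IUT.LogThetaLattice.Prop35ii_a` (unit groups `U m` with Kummer maps `κ m` for
`m' = 0`, partial log-iterate pre-composites `lam m m'` for `m' ≥ 1`), then Prop. 3.5 (ii) (a) yields
the non-archimedean containments of `Column.Ind3`. [claim: Mochizuki2012, status: disputed] -/
theorem ind3_non_of_prop35ii_a (j : T.Label) (vQ : T.VQ) (U : ℤ → Type)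
    (κ : ∀ m, U m → L.Packet j vQ) (lam : ∀ (m : ℤ) (m' : ℕ), 1 ≤ m' → U m → Option (L.Packet j vQ))
    (h : Prop35ii_a (D.shellPk j vQ) U κ lam)
    (h0 : ∀ m, C.unitImage m 0 j vQ = Set.range (κ m))
    (hS : ∀ (m : ℤ) (m' : ℕ) (hm : 1 ≤ m'), C.unitImage m m' j vQ = {x | ∃ u, lam m m' hm u = some x}) :
    ∀ (m : ℤ) (m' : ℕ), C.unitImage m m' j vQ ⊆ D.shellPk j vQ := by
  intro m m'
  rcases m' with _ | k
  · rw [h0 m]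
    rintro x ⟨u, rfl⟩
    exact h.1 m u
  · rw [hS m (k + 1) (by omega)]
    rintro x ⟨u, hu⟩
    exact h.2 m (k + 1) (by omega) u x hu

end Column

/-! ## The procession normalization of G is the Literature's `processionNormalized` -/

namespace PilotNouns

variable {S : LatticeSituation T} (P : PilotNouns S)

/-- DICTIONARY: `−|log(Θ)|` of G, `(1/l⋇) Σ_{j ∈ F_l^⋇} Σ_{v_ℚ} μ^log(Uhol)`, is
`Literature.IUT.LogThetaLattice.processionNormalized` (PacketLogVolumes: "`(Σ_j vol j) / l⋇`") of the
global log-volumes, for any enumeration `Fin l⋇ ≃ F_l^⋇`. [claim: Mochizuki2012, status: disputed] -/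
theorem negLogTheta_eq_processionNormalized (n m : ℤ) (e : Fin T.lstar ≃ T.LabelStar) :
    P.negLogTheta n m =
      processionNormalized fun j : Fin T.lstar =>
        ∑ᶠ vQ : T.VQ, (S.D n).logvol (e j).1 vQ (P.Uhol n m (e j) vQ) := by
  unfold negLogTheta processionNormalized
  rw [finsum_eq_sum_of_fintype,
    ← Fintype.sum_equiv e (fun j => ∑ᶠ vQ : T.VQ, (S.D n).logvol (e j).1 vQ (P.Uhol n m (e j) vQ))
      (fun j => ∑ᶠ vQ : T.VQ, (S.D n).logvol j.1 vQ (P.Uhol n m j vQ)) (fun _ => rfl)]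
  ring

/-- Same for `−|log(q)|`. [claim: Mochizuki2012, status: disputed] -/
theorem negLogQ_eq_processionNormalized (n m : ℤ) (e : Fin T.lstar ≃ T.LabelStar) :
    P.negLogQ n m =
      processionNormalized fun j : Fin T.lstar =>
        ∑ᶠ vQ : T.VQ, (S.D n).logvol (e j).1 vQ (P.qRegion n m (e j) vQ) := by
  unfold negLogQ processionNormalized
  rw [finsum_eq_sum_of_fintype,
    ← Fintype.sum_equiv e (fun j => ∑ᶠ vQ : T.VQ, (S.D n).logvol (e j).1 vQ (P.qRegion n m (e j) vQ))
      (fun j => ∑ᶠ vQ : T.VQ, (S.D n).logvol j.1 vQ (P.qRegion n m j vQ)) (fun _ => rfl)]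
  ring

/-- Such an enumeration exists: `|F_l^⋇| = l⋇`. [folklore] -/
theorem card_labelStar (T : ThetaIndex) : Fintype.card T.LabelStar = T.lstar := by
  unfold ThetaIndex.LabelStar
  rw [Fintype.card_subtype_compl, Fintype.card_fin, Fintype.card_subtype_eq]
  omega

/-- An enumeration `Fin l⋇ ≃ F_l^⋇`. [folklore] -/
def labelStarEquiv (T : ThetaIndex) : Fin T.lstar ≃ T.LabelStar :=
  (Fintype.equivFinOfCardEq (card_labelStar T)).symm

end PilotNouns

end Thm311

end IUTFork

end Summit.ABC

end
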